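import Summits.ValiantsHypothesis.ValiantsHypothesis.Theses.LacunarySymmetroid
import Summits.ValiantsHypothesis.ValiantsHypothesis.Theorems.LacunarySymmetroidMatrixDescartesStubPsdDominate
import Summits.ValiantsHypothesis.ValiantsHypothesis.Theorems.LacunarySymmetroidMatrixDescartesStubPsdBlocks
import Summits.ValiantsHypothesis.ValiantsHypothesis.Theorems.LacunarySymmetroidMatrixDescartesStubLiftDet
import Summits.ValiantsHypothesis.ValiantsHypothesis.Theorems.LacunarySymmetroidMatrixDescartesStubArith
import Summits.ValiantsHypothesis.ValiantsHypothesis.Theorems.LacunarySymmetroidMatrixDescartesStubNegRoots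
import Summits.ValiantsHypothesis.ValiantsHypothesis.Theorems.LacunarySymmetroidMatrixDescartesStubArith3
import Summits.ValiantsHypothesis.ValiantsHypothesis.Theorems.LacunarySymmetroidMatrixDescartesStubArith4
import Summits.ValiantsHypothesis.ValiantsHypothesis.Theorems.LacunarySymmetroidMatrixDescartesStubReverse
import Summits.ValiantsHypothesis.ValiantsHypothesis.Theorems.LacunarySymmetroidMatrixDescartesStubKernelData
import Summits.ValiantsHypothesis.ValiantsHypothesis.Theorems.LacunarySymmetroidMatrixDescartesStubInertiaChain
import Summits.ValiantsHypothesis.ValiantsHypothesis.Theorems.LacunarySymmetroidMatrixDescartesStubDiagonalSector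
import Summits.ValiantsHypothesis.ValiantsHypothesis.Theorems.LacunarySymmetroidMatrixDescartesStubCommutingSector
import Summits.ValiantsHypothesis.ValiantsHypothesis.Theorems.LacunarySymmetroidMatrixDescartesStubBlockSector
import Summits.ValiantsHypothesis.ValiantsHypothesis.Theorems.LacunarySymmetroidMatrixDescartesStubKroneckerSector
import Summits.ValiantsHypothesis.ValiantsHypothesis.Theorems.LacunarySymmetroidMatrixDescartesStubDescartesCeiling
import Summits.ValiantsHypothesis.ValiantsHypothesis.Theorems.MatrixDescartes.Negative.MatrixDescartesFalseOfTropicalMonster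
import Literature.Computability.AlgebraicComplexity.BirkhoffShadow
import Summits.ValiantsHypothesis.ValiantsHypothesis.Theorems.LacunarySymmetroidMatrixDescartesStubDominantInjective
import Summits.ValiantsHypothesis.ValiantsHypothesis.Theorems.LacunarySymmetroidMatrixDescartesStubShadowEmbed
import Summits.ValiantsHypothesis.ValiantsHypothesis.Theorems.LacunarySymmetroidMatrixDescartesStubShadowTransport
import Summits.ValiantsHypothesis.ValiantsHypothesis.Theorems.LacunarySymmetroidMatrixDescartesStubShadowArith
import Summits.ValiantsHypothesis.ValiantsHypothesis.Theorems.LacunarySymmetroidMatrixDescartesStubVLawTwo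
import Summits.ValiantsHypothesis.ValiantsHypothesis.Theorems.LacunarySymmetroidMatrixDescartesStubVLaw
import Summits.ValiantsHypothesis.ValiantsHypothesis.Theorems.LacunarySymmetroidMatrixDescartesStubCommutingTwoSided
import Summits.ValiantsHypothesis.ValiantsHypothesis.Theorems.LacunarySymmetroidMatrixDescartesWLawTwoWitness

/-!
# Crux `MatrixDescartes` — line `Lift` (PSD lift; card `psd-lift-loewner-descartes`), skeleton v15

Skeleton owned by the line lead (`prover-line-stmt-ValiantsHypothesis-18050-0`; continuations c1, c2, c3).

v6/v7 (lead `prover-line-stmt-ValiantsHypothesis-18050-c3-0`): composition unchanged (ONE crux-equivalent sorry,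
`stub_twoSided`); v6 REGISTERED five K-DEPENDENT SECTOR SUB-GOALS of the stuck stub's territory, all LANDED by
wave 1 (c3) and discharged in v7 by the tree theorems (p167534 `stub_diagonalSector`, p167802
`stub_commutingSector`, p167399 `stub_blockSector`, p167544 `stub_kroneckerSector`, p167511
`stub_descartesCeiling`): `stub_diagonalSector` / `stub_commutingSector`
(`Z₊ ≤ m (K − 1)` for simultaneously diagonalisable coefficients — the route header's "commuting Sₗ" sector),
`stub_blockSector` / `stub_kroneckerSector` (block sums and Kronecker products of pencils are ADDITIVE in the
real-zero count — the negation map's "no multiplying mechanism by composition", Disproof §D.1, as theorems),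
`stub_descartesCeiling` (the sharp trivial bound `Z₊ + 1 ≤ C(m+K−1, m)` by count vectors, against which
Descartes-extremality of witnesses is measured).  See the last section of this file.

v1/v2 (transfer in total-root currency): the four delegated stubs `stub_psdDominate` (p147024),
`stub_psdBlocks` (p147006), `stub_liftDet` (p148960), `stub_arith` (p147140) LANDED and are imported.

v3 (this file) moves to POSITIVE-ROOT currency, which is where the structure lives (see
`Cruxes/MatrixDescartes/UniversalityV2.md`): the transfer target is
`OneIndefiniteDescartesPos` (C⁺₊: the matrix Descartes rule for the number `Z₊` of distinct POSITIVE
zeros of `det (X^e J + ∑ₖ X^{dₖ} Pₖ)`, `Pₖ ⪰ 0`, one constant symmetric `J`), and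

* `MatrixDescartes_of_oneIndefinitePos` (glue, proved modulo `stub_negRoots`, `stub_arith3`): lift `F(X)`
  AND `F(−X)` (both symmetric lacunary pencils), `Z ≤ Z₊(F) + Z₊(F(−X)) + 1`, `Z₊` is invariant under
  `det L = a·X^M·det F`;
* `oneIndefinitePos_of_stubs` (glue): C⁺₊ by cases — the ONE-SIDED sector (`e ≤ min d` or `e ≥ max d`,
  the Loewner / `V ≤ 1`-with-indefinite-pivot rung: `Z₊ ≤ card ι`, K-free) from `stub_kernelData` +
  `stub_inertiaChain` (+ `stub_reverse` for the mirror case, + `stub_arith4` for the regime), and the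
  TWO-SIDED remainder `stub_twoSided` (PSD terms on both sides of the pivot — the universal word
  `(+)^a [±] (+)^b`, crux-equivalent; held by the lead).

v4/v5 (lead `prover-line-stmt-ValiantsHypothesis-18050-c1-0`): the six delegated v3 stubs `stub_negRoots`
(p151025), `stub_arith3` (p150758), `stub_arith4` (p150743), `stub_reverse` (p150946), `stub_kernelData`
(p150970), `stub_inertiaChain` (p150875) are LANDED and discharged here by the tree theorems (their
statements are kept verbatim as local aliases; v5 imports `StubNegRoots` again now that
`SymmetroidDescartesRolleToDescartes` builds, p159687); the ONLY sorry left is `stub_twoSided` (lead; ≅ crux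
by `Theorems/MatrixDescartes/Negative/MatrixDescartesOneIndefiniteIff`).  Negative calibrations of its K-free
rung candidates: `not_rankOneLaw_two` (p159188), `not_definiteLaw_two` / `cameronPsarrakos_counterexample`
(p161614).
-/

-- `Summit.ValiantsHypothesis.ValiantsHypothesis.…` is the tree's mandated single-conjunct layout.
set_option linter.dupNamespace false

namespace Summit.ValiantsHypothesis.ValiantsHypothesis.Cruxes.MatrixDescartes.Lift

open Polynomial Matrix Finset
open scoped BigOperators

/-! ## The transfer target -/

/-- **C⁺₊ (`OneIndefiniteDescartesPos`)**: the matrix Descartes rule, in POSITIVE-root currency, for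
lacunary pencils `X^e • J + ∑ₖ X^{d k} • P k` all of whose coefficients `P k` are positive
semidefinite except for ONE constant real symmetric matrix `J` (with its own exponent `e`); arbitrary
finite index types (`ι`: matrix, `κ`: PSD terms); same quantifier shape and bound as the crux. -/
def OneIndefiniteDescartesPos : Prop :=
  ∀ c q : ℕ, 0 < q → ∃ K₀ : ℕ, ∀ (ι κ : Type) [Fintype ι] [DecidableEq ι] [Fintype κ],
    K₀ ≤ Fintype.card κ → Fintype.card ι ≤ 2 ^ ((Nat.log 2 (Fintype.card κ) + c) ^ c) →
    ∀ (e : ℕ) (d : κ → ℕ) (J : Matrix ι ι ℝ) (P : κ → Matrix ι ι ℝ),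
      J.IsSymm → (∀ k, (P k).PosSemidef) →
      ((Matrix.det (((Polynomial.X : Polynomial ℝ) ^ e) • J.map Polynomial.C
          + ∑ k, ((Polynomial.X : Polynomial ℝ) ^ d k) • (P k).map Polynomial.C)).roots.toFinset.filter
            (fun t => 0 < t)).card ^ q
        ≤ 2 ^ (Fintype.card κ * Nat.log 2 (Fintype.card κ))

/-! ## Stubs (tree-expressible signatures) -/

/-- STUB `stub_negRoots` (LANDED p151025): all distinct real roots of the determinant of a lacunary pencil =
positive roots + positive roots of the pencil with `Sₗ ↦ (−1)^{dₗ} Sₗ` + possibly the root `0`. -/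
theorem stub_negRoots (K m : ℕ) (d : Fin K → ℕ) (S : Fin K → Matrix (Fin m) (Fin m) ℝ) :
    (Matrix.det (∑ l, ((Polynomial.X : Polynomial ℝ) ^ d l) • (S l).map Polynomial.C)).roots.toFinset.card
      ≤ ((Matrix.det (∑ l, ((Polynomial.X : Polynomial ℝ) ^ d l) • (S l).map Polynomial.C)).roots.toFinset.filter
            (fun t => 0 < t)).card
        + ((Matrix.det (∑ l, ((Polynomial.X : Polynomial ℝ) ^ d l) •
              (((-1 : ℝ) ^ d l) • S l).map Polynomial.C)).roots.toFinset.filter (fun t => 0 < t)).card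
        + 1 :=
  Summit.ValiantsHypothesis.ValiantsHypothesis.Theorems.LacunarySymmetroidMatrixDescartes.stub_negRoots K m d S

/-- STUB (arithmetic of the two-lift transfer `(c, q, K) ↦ (c + 2, 4q, 2K)`):
`Z ≤ A + B + 1`, `A^{4q}, B^{4q} ≤ 2^{2K ⌊log₂ 2K⌋}` give `Z^q ≤ 2^{K ⌊log₂ K⌋}` once `K ≥ 4` and `K ≥ 4q`. -/
theorem stub_arith3 (K q A B Z : ℕ) (hK : 4 ≤ K) (hqK : 4 * q ≤ K) (hZ : Z ≤ A + B + 1)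
    (hA : A ^ (4 * q) ≤ 2 ^ ((K + K) * Nat.log 2 (K + K)))
    (hB : B ^ (4 * q) ≤ 2 ^ ((K + K) * Nat.log 2 (K + K))) :
    Z ^ q ≤ 2 ^ (K * Nat.log 2 K) :=
  Summit.ValiantsHypothesis.ValiantsHypothesis.Theorems.LacunarySymmetroidMatrixDescartes.stub_arith3 K q A B Z hK hqK hZ hA hB

/-- STUB (the regime absorbs polynomial counts): in the regime `n ≤ 2^((⌊log₂K⌋+c)^c)` one has
`n^q ≤ 2^(K ⌊log₂ K⌋)` for all large `K`. -/
theorem stub_arith4 (c q : ℕ) : ∃ K₁ : ℕ, ∀ K n : ℕ, K₁ ≤ K →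
    n ≤ 2 ^ ((Nat.log 2 K + c) ^ c) → n ^ q ≤ 2 ^ (K * Nat.log 2 K) :=
  Summit.ValiantsHypothesis.ValiantsHypothesis.Theorems.LacunarySymmetroidMatrixDescartes.stub_arith4 c q

/-- STUB (reversal `X ↦ 1/X`): the number of distinct positive zeros of `det (X^e J + ∑ₖ X^{dₖ} Pₖ)` is
unchanged when all exponents are reflected, `e ↦ N − e`, `dₖ ↦ N − dₖ` (`N ≥ e, dₖ`): for `t > 0`,
`det(reflected)(t) = t^{N·card ι} · det(original)(1/t)`. No symmetry or definiteness is needed. -/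
theorem stub_reverse (ι κ : Type) [Fintype ι] [DecidableEq ι] [Fintype κ] (e N : ℕ) (d : κ → ℕ)
    (J : Matrix ι ι ℝ) (P : κ → Matrix ι ι ℝ) (he : e ≤ N) (hd : ∀ k, d k ≤ N) :
    ((Matrix.det (((Polynomial.X : Polynomial ℝ) ^ e) • J.map Polynomial.C
        + ∑ k, ((Polynomial.X : Polynomial ℝ) ^ d k) • (P k).map Polynomial.C)).roots.toFinset.filter
          (fun t => 0 < t)).card
      = ((Matrix.det (((Polynomial.X : Polynomial ℝ) ^ (N - e)) • J.map Polynomial.C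
        + ∑ k, ((Polynomial.X : Polynomial ℝ) ^ (N - d k)) • (P k).map Polynomial.C)).roots.toFinset.filter
          (fun t => 0 < t)).card :=
  Summit.ValiantsHypothesis.ValiantsHypothesis.Theorems.LacunarySymmetroidMatrixDescartes.stub_reverse ι κ e N d J P he hd

/-- STUB (kernel data at a positive root, one-sided sector): if `e ≤ dₖ` for all `k`, put
`G(t) := J + ∑ₖ t^{dₖ−e} Pₖ` (real symmetric, Loewner non-decreasing on `t > 0`); then
`det(X^e J + ∑ₖ X^{dₖ} Pₖ)(t) = t^{e·card ι} det G(t)`, so at a positive root `t₀` there is `v ≠ 0` with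
`G(t₀) v = 0`; and if the determinant is not the zero polynomial then `vᵀ G(s) v > 0` for every
`s > t₀` (otherwise `vᵀ(G(s) − G(t₀))v = 0` with `G(s) − G(t₀) ⪰ 0` forces `G(s')v = 0`, i.e.
`det G(s') = 0`, for all `s' ∈ [t₀, s]` — infinitely many roots).  Mathlib:
`Matrix.exists_mulVec_eq_zero_iff`, `RingHom.map_det`, `Matrix.PosSemidef.dotProduct_mulVec_zero_iff`
(file Mathlib/Analysis/Matrix/Order.lean), `Polynomial.eq_zero_of_infinite_isRoot`. -/
theorem stub_kernelData (ι κ : Type) [Fintype ι] [DecidableEq ι] [Fintype κ] (e : ℕ) (d : κ → ℕ)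
    (J : Matrix ι ι ℝ) (P : κ → Matrix ι ι ℝ) (hJ : J.IsSymm) (hP : ∀ k, (P k).PosSemidef)
    (hd : ∀ k, e ≤ d k)
    (hdet : Matrix.det (((Polynomial.X : Polynomial ℝ) ^ e) • J.map Polynomial.C
        + ∑ k, ((Polynomial.X : Polynomial ℝ) ^ d k) • (P k).map Polynomial.C) ≠ 0)
    (t₀ : ℝ) (ht₀ : 0 < t₀)
    (hroot : (Matrix.det (((Polynomial.X : Polynomial ℝ) ^ e) • J.map Polynomial.C
        + ∑ k, ((Polynomial.X : Polynomial ℝ) ^ d k) • (P k).map Polynomial.C)).IsRoot t₀) :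
    ∃ v : ι → ℝ, v ≠ 0 ∧ (J + ∑ k, (t₀ ^ (d k - e)) • P k) *ᵥ v = 0 ∧
      ∀ s : ℝ, t₀ < s → 0 < v ⬝ᵥ ((J + ∑ k, (s ^ (d k - e)) • P k) *ᵥ v) :=
  Summit.ValiantsHypothesis.ValiantsHypothesis.Theorems.LacunarySymmetroidMatrixDescartes.stub_kernelData ι κ e d J P hJ hP hd hdet t₀ ht₀ hroot

/-- STUB (the inertia chain — pure linear algebra): a family of real symmetric matrices `G s` that is
Loewner non-decreasing on `s > 0`, points `0 < τ 0 < τ 1 < ⋯ < τ (k−1)` and vectors `v j` with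
`G (τ j) (v j) = 0` and `vⱼᵀ G(s) vⱼ > 0` for all `s > τ j` force `k ≤ card ι`: the subspaces
`U_j = span(v 0, …, v (j−1))` have dimension `j` and `G(s)` is positive definite on `U_j` for `s > τ (j−1)`
(for `w = u + α vⱼ`: `wᵀG(s)w ≥ wᵀG(τⱼ)w = uᵀG(τⱼ)u`, strict unless `u = 0`, and then `α² vⱼᵀG(s)vⱼ > 0`). -/
theorem stub_inertiaChain (ι : Type) [Fintype ι] [DecidableEq ι] (G : ℝ → Matrix ι ι ℝ)
    (hG : ∀ s, (G s).IsSymm) (hmono : ∀ s t : ℝ, 0 < s → s ≤ t → (G t - G s).PosSemidef)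
    (k : ℕ) (τ : Fin k → ℝ) (hτ : StrictMono τ) (hτpos : ∀ j, 0 < τ j) (v : Fin k → (ι → ℝ))
    (hker : ∀ j, G (τ j) *ᵥ v j = 0) (hpos : ∀ j (s : ℝ), τ j < s → 0 < v j ⬝ᵥ (G s *ᵥ v j)) :
    k ≤ Fintype.card ι :=
  Summit.ValiantsHypothesis.ValiantsHypothesis.Theorems.LacunarySymmetroidMatrixDescartes.stub_inertiaChain ι G hG hmono k τ hτ hτpos v hker hpos

/-- STUB (the hard one, crux-equivalent by `UniversalityV2.md`; held by the lead): C⁺₊ for pencils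
with PSD terms on BOTH sides of the pivot exponent `e` — the universal word `(+)^a [±] (+)^b`. -/
theorem stub_twoSided : ∀ c q : ℕ, 0 < q → ∃ K₀ : ℕ, ∀ (ι κ : Type) [Fintype ι] [DecidableEq ι] [Fintype κ],
    K₀ ≤ Fintype.card κ → Fintype.card ι ≤ 2 ^ ((Nat.log 2 (Fintype.card κ) + c) ^ c) →
    ∀ (e : ℕ) (d : κ → ℕ) (J : Matrix ι ι ℝ) (P : κ → Matrix ι ι ℝ),
      J.IsSymm → (∀ k, (P k).PosSemidef) → (∃ k, d k < e) → (∃ k, e < d k) →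
      ((Matrix.det (((Polynomial.X : Polynomial ℝ) ^ e) • J.map Polynomial.C
          + ∑ k, ((Polynomial.X : Polynomial ℝ) ^ d k) • (P k).map Polynomial.C)).roots.toFinset.filter
            (fun t => 0 < t)).card ^ q
        ≤ 2 ^ (Fintype.card κ * Nat.log 2 (Fintype.card κ)) := by
  sorry

/-! ## Glue I: the one-sided sector (first rung, `Z₊ ≤ card ι`) and C⁺₊ from the stubs -/

/-- **First rung (one-sided below)**: if `e ≤ dₖ` for all `k`, the pencil `X^e J + ∑ X^{dₖ} Pₖ`
(`J` symmetric, `Pₖ ⪰ 0`) has at most `card ι` distinct positive zeros of its determinant. -/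
theorem posRoots_le_card_of_low (ι κ : Type) [Fintype ι] [DecidableEq ι] [Fintype κ] (e : ℕ) (d : κ → ℕ)
    (J : Matrix ι ι ℝ) (P : κ → Matrix ι ι ℝ) (hJ : J.IsSymm) (hP : ∀ k, (P k).PosSemidef)
    (hd : ∀ k, e ≤ d k) :
    ((Matrix.det (((Polynomial.X : Polynomial ℝ) ^ e) • J.map Polynomial.C
        + ∑ k, ((Polynomial.X : Polynomial ℝ) ^ d k) • (P k).map Polynomial.C)).roots.toFinset.filter
          (fun t => 0 < t)).card ≤ Fintype.card ι := by
  set p := Matrix.det (((Polynomial.X : Polynomial ℝ) ^ e) • J.map Polynomial.C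
        + ∑ k, ((Polynomial.X : Polynomial ℝ) ^ d k) • (P k).map Polynomial.C) with hp
  by_cases hdet : p = 0
  · simp [hdet]
  -- enumerate the positive roots increasingly
  set R := p.roots.toFinset.filter (fun t => 0 < t) with hR
  let τ : Fin R.card ↪o ℝ := R.orderEmbOfFin rfl
  have hτmem : ∀ j, τ j ∈ R := fun j => R.orderEmbOfFin_mem rfl j
  have hτpos : ∀ j, 0 < τ j := fun j => (Finset.mem_filter.1 (hτmem j)).2
  have hτroot : ∀ j, p.IsRoot (τ j) := fun j => by
    have h1 := (Finset.mem_filter.1 (hτmem j)).1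
    rw [Multiset.mem_toFinset] at h1
    exact (Polynomial.mem_roots hdet).1 h1
  -- kernel data at each root
  have hdata : ∀ j, ∃ v : ι → ℝ, v ≠ 0 ∧ (J + ∑ k, (τ j ^ (d k - e)) • P k) *ᵥ v = 0 ∧
      ∀ s : ℝ, τ j < s → 0 < v ⬝ᵥ ((J + ∑ k, (s ^ (d k - e)) • P k) *ᵥ v) := fun j =>
    stub_kernelData ι κ e d J P hJ hP hd hdet (τ j) (hτpos j) (hτroot j)
  choose v _hv0 hker hpos using hdata
  -- the Loewner-monotone family
  have hPk : ∀ k, (P k).IsSymm := fun k => Matrix.isHermitian_iff_isSymm.1 (hP k).1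
  have hG : ∀ s : ℝ, (J + ∑ k, (s ^ (d k - e)) • P k).IsSymm := by
    intro s
    unfold Matrix.IsSymm
    rw [Matrix.transpose_add, Matrix.transpose_sum, hJ.eq]
    congr 1
    exact Finset.sum_congr rfl fun k _ => by rw [Matrix.transpose_smul, (hPk k).eq]
  have hmono : ∀ s t : ℝ, 0 < s → s ≤ t →
      ((J + ∑ k, (t ^ (d k - e)) • P k) - (J + ∑ k, (s ^ (d k - e)) • P k)).PosSemidef := by
    intro s t hs hst
    have hdiff : (J + ∑ k, (t ^ (d k - e)) • P k) - (J + ∑ k, (s ^ (d k - e)) • P k)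
        = ∑ k, (t ^ (d k - e) - s ^ (d k - e)) • P k := by
      simp only [sub_smul, Finset.sum_sub_distrib]
      abel
    rw [hdiff]
    refine Matrix.posSemidef_sum Finset.univ fun k _ => ?_
    exact (hP k).smul (sub_nonneg.2 (pow_le_pow_left₀ hs.le hst _))
  exact stub_inertiaChain ι (fun s => J + ∑ k, (s ^ (d k - e)) • P k) hG hmono R.card τ
    τ.strictMono hτpos v hker hpos

/-- **First rung (one-sided above)**: the mirror case `dₖ ≤ e` for all `k`, by reversal. -/
theorem posRoots_le_card_of_high (ι κ : Type) [Fintype ι] [DecidableEq ι] [Fintype κ] (e : ℕ)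
    (d : κ → ℕ) (J : Matrix ι ι ℝ) (P : κ → Matrix ι ι ℝ) (hJ : J.IsSymm) (hP : ∀ k, (P k).PosSemidef)
    (hd : ∀ k, d k ≤ e) :
    ((Matrix.det (((Polynomial.X : Polynomial ℝ) ^ e) • J.map Polynomial.C
        + ∑ k, ((Polynomial.X : Polynomial ℝ) ^ d k) • (P k).map Polynomial.C)).roots.toFinset.filter
          (fun t => 0 < t)).card ≤ Fintype.card ι := by
  rw [stub_reverse ι κ e e d J P le_rfl hd]
  exact posRoots_le_card_of_low ι κ (e - e) (fun k => e - d k) J P hJ hP (fun k => by omega)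

/-- **C⁺₊ from the stubs**: one-sided sector by the first rung (absorbed by the regime), two-sided
remainder by `stub_twoSided`. -/
theorem oneIndefinitePos_of_stubs : OneIndefiniteDescartesPos := by
  intro c q hq
  obtain ⟨K₂, hK₂⟩ := stub_twoSided c q hq
  obtain ⟨K₁, hK₁⟩ := stub_arith4 c q
  refine ⟨max K₁ K₂, ?_⟩
  intro ι κ _ _ _ hK hsize e d J P hJ hP
  by_cases htwo : (∃ k, d k < e) ∧ (∃ k, e < d k)
  · exact hK₂ ι κ (le_trans (le_max_right _ _) hK) hsize e d J P hJ hP htwo.1 htwo.2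
  · -- one-sided: `Z₊ ≤ card ι ≤ 2^((L+c)^c)`, absorbed by the regime
    have hone : (∀ k, e ≤ d k) ∨ (∀ k, d k ≤ e) := by
      by_contra hcon
      push Not at hcon
      obtain ⟨⟨k₁, hk₁⟩, ⟨k₂, hk₂⟩⟩ := hcon
      exact htwo ⟨⟨k₁, hk₁⟩, ⟨k₂, hk₂⟩⟩
    have hZ : ((Matrix.det (((Polynomial.X : Polynomial ℝ) ^ e) • J.map Polynomial.C
        + ∑ k, ((Polynomial.X : Polynomial ℝ) ^ d k) • (P k).map Polynomial.C)).roots.toFinset.filter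
          (fun t => 0 < t)).card ≤ Fintype.card ι := by
      rcases hone with h | h
      · exact posRoots_le_card_of_low ι κ e d J P hJ hP h
      · exact posRoots_le_card_of_high ι κ e d J P hJ hP h
    exact le_trans (Nat.pow_le_pow_left hZ q)
      (hK₁ (Fintype.card κ) (Fintype.card ι) (le_trans (le_max_left _ _) hK) hsize)

/-! ## Glue II: the transfer C⁺₊ ⟹ crux (two lifts: `F(X)` and `F(−X)`) -/

/-- Positive-root bookkeeping: if `g = C a * X ^ M * f` with `a ≠ 0` then `f` and `g` have the same
distinct positive roots. -/
theorem posRoots_eq_of_eq_C_mul_X_pow_mul (f g : Polynomial ℝ) (a : ℝ) (M : ℕ) (ha : a ≠ 0)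
    (h : g = Polynomial.C a * (Polynomial.X : Polynomial ℝ) ^ M * f) :
    (g.roots.toFinset.filter (fun t => 0 < t)) = (f.roots.toFinset.filter (fun t => 0 < t)) := by
  by_cases hf : f = 0
  · simp [h, hf]
  · have hCX : Polynomial.C a * (Polynomial.X : Polynomial ℝ) ^ M ≠ 0 :=
      mul_ne_zero (Polynomial.C_ne_zero.mpr ha) (pow_ne_zero _ Polynomial.X_ne_zero)
    have hprod : Polynomial.C a * (Polynomial.X : Polynomial ℝ) ^ M * f ≠ 0 := mul_ne_zero hCX hf
    rw [h, Polynomial.roots_mul hprod, Polynomial.roots_C_mul_X_pow ha, Multiset.toFinset_add,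
      Finset.filter_union]
    have h0 : ((M • ({0} : Multiset ℝ)).toFinset.filter (fun t => (0 : ℝ) < t)) = ∅ := by
      ext t
      simp only [Finset.mem_filter, Multiset.mem_toFinset, Multiset.mem_nsmul, Multiset.mem_singleton,
        Finset.notMem_empty, iff_false, not_and, not_lt]
      rintro ⟨-, rfl⟩
      exact le_rfl
    rw [h0, Finset.empty_union]

/-- **The transfer** (proved modulo `stub_negRoots`, `stub_arith3` and the v1 stubs): C⁺₊ implies the
crux — stated with the crux UNFOLDED (verbatim body of `LacunarySymmetroid.MatrixDescartes`). -/
theorem MatrixDescartes_of_oneIndefinitePos (h : OneIndefiniteDescartesPos) :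
    ∀ c q : ℕ, 0 < q → ∃ K₀ : ℕ, ∀ K m : ℕ, K₀ ≤ K → m ≤ 2 ^ ((Nat.log 2 K + c) ^ c) →
      ∀ (d : Fin K → ℕ) (S : Fin K → Matrix (Fin m) (Fin m) ℝ), (∀ l, (S l).IsSymm) →
        (Matrix.det (∑ l, ((Polynomial.X : Polynomial ℝ) ^ d l) • (S l).map Polynomial.C)
          ).roots.toFinset.card ^ q ≤ 2 ^ (K * Nat.log 2 K) := by
  intro c q hq
  obtain ⟨K₀', hK'⟩ := h (c + 2) (4 * q) (by omega)
  refine ⟨max K₀' (max 4 (4 * q)), ?_⟩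
  intro K m hK hm d S hS
  have hK4 : 4 ≤ K := le_trans (le_max_left _ _) (le_trans (le_max_right _ _) hK)
  have hKq : 4 * q ≤ K := le_trans (le_max_right _ _) (le_trans (le_max_right _ _) hK)
  have hK₀' : K₀' ≤ K := le_trans (le_max_left _ _) hK
  -- size / term bookkeeping (shared by both lifts)
  let ι : Type := (Fin m × Fin K) ⊕ Fin m
  let κ : Type := Fin K ⊕ Fin K
  have hcardκ : Fintype.card κ = K + K := by
    simp [κ, Fintype.card_sum, Fintype.card_fin]
  have hcardι : Fintype.card ι = m * K + m := by
    simp [ι, Fintype.card_sum, Fintype.card_prod, Fintype.card_fin]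
  have hlogK : Nat.log 2 (K + K) = Nat.log 2 K + 1 := by
    rw [← two_mul, mul_comm]
    exact Nat.log_mul_base (by norm_num) (by omega)
  have hK₀κ : K₀' ≤ Fintype.card κ := by rw [hcardκ]; omega
  have hsize : Fintype.card ι ≤ 2 ^ ((Nat.log 2 (Fintype.card κ) + (c + 2)) ^ (c + 2)) := by
    rw [hcardι, hcardκ, hlogK]
    have hK1 : K + 1 ≤ 2 ^ (Nat.log 2 K + 1) := Nat.lt_pow_succ_log_self (by norm_num) K
    calc m * K + m = m * (K + 1) := by ring
      _ ≤ 2 ^ ((Nat.log 2 K + c) ^ c) * 2 ^ (Nat.log 2 K + 1) := Nat.mul_le_mul hm hK1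
      _ = 2 ^ (Nat.log 2 K + 1 + (Nat.log 2 K + c) ^ c) := by rw [← pow_add]; ring_nf
      _ ≤ 2 ^ ((Nat.log 2 K + 1 + (c + 2)) ^ (c + 2)) :=
          Nat.pow_le_pow_right (by norm_num)
            (Summit.ValiantsHypothesis.ValiantsHypothesis.Theorems.LacunarySymmetroidMatrixDescartes.stub_arith.1
              c (Nat.log 2 K))
  set e : ℕ := ∑ l, d l with hedef
  have he : ∀ l, d l ≤ e := fun l =>
    Finset.single_le_sum (f := d) (fun i _ => Nat.zero_le _) (Finset.mem_univ l)
  let W : Matrix (Fin m) (Fin m × Fin K) ℝ :=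
    Matrix.of fun (i : Fin m) (jl : Fin m × Fin K) => if i = jl.1 then (1 : ℝ) else 0
  let J : Matrix ι ι ℝ :=
    Matrix.fromBlocks (0 : Matrix (Fin m × Fin K) (Fin m × Fin K) ℝ) Wᵀ W (0 : Matrix (Fin m) (Fin m) ℝ)
  have hJ : J.IsSymm := by
    show (Matrix.fromBlocks 0 Wᵀ W 0)ᵀ = Matrix.fromBlocks 0 Wᵀ W 0
    rw [Matrix.fromBlocks_transpose, Matrix.transpose_zero, Matrix.transpose_zero,
      Matrix.transpose_transpose]
  let d' : κ → ℕ := Sum.elim (fun l => e - d l) (fun l => e + d l)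
  -- the lift of a symmetric family `T` (used for `T = S` and `T = (−1)^d • S`)
  have hlift : ∀ T : Fin K → Matrix (Fin m) (Fin m) ℝ, (∀ l, (T l).IsSymm) →
      ((Matrix.det (∑ l, ((Polynomial.X : Polynomial ℝ) ^ d l) • (T l).map Polynomial.C)
        ).roots.toFinset.filter (fun t => 0 < t)).card ^ (4 * q) ≤ 2 ^ ((K + K) * Nat.log 2 (K + K)) := by
    intro T hT
    set γ : Fin K → ℝ := fun l => 1 + ∑ i, ∑ j, T l i j ^ 2 with hγdef
    have hγpos : ∀ l, 0 < γ l := fun l => by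
      simp only [hγdef]
      positivity
    have hγ : ∀ l, γ l ≠ 0 := fun l => ne_of_gt (hγpos l)
    let P : κ → Matrix ι ι ℝ := Sum.elim
      (fun l => Matrix.fromBlocks
        (Matrix.diagonal fun jl : Fin m × Fin K => if jl.2 = l then (γ l)⁻¹ else 0)
        0 0 (0 : Matrix (Fin m) (Fin m) ℝ))
      (fun l => Matrix.fromBlocks (0 : Matrix (Fin m × Fin K) (Fin m × Fin K) ℝ) 0 0
        (γ l • (1 : Matrix (Fin m) (Fin m) ℝ) - T l))
    have hP : ∀ k, (P k).PosSemidef := by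
      obtain ⟨h1, h2⟩ :=
        Summit.ValiantsHypothesis.ValiantsHypothesis.Theorems.LacunarySymmetroidMatrixDescartes.stub_psdBlocks K m
      intro k
      cases k with
      | inl l =>
          simp only [P, Sum.elim_inl]
          exact h1 l _ (le_of_lt (inv_pos.mpr (hγpos l)))
      | inr l =>
          simp only [P, Sum.elim_inr]
          exact h2 _ (by
            simpa [hγdef] using
              Summit.ValiantsHypothesis.ValiantsHypothesis.Theorems.LacunarySymmetroidMatrixDescartes.stub_psdDominate
                m (T l) (hT l))
    have hC := hK' ι κ hK₀κ hsize e d' J P hJ hP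
    rw [hcardκ] at hC
    have hsum : ∑ k, ((Polynomial.X : Polynomial ℝ) ^ d' k) • (P k).map Polynomial.C
        = ∑ l : Fin K, ((Polynomial.X : Polynomial ℝ) ^ (e - d l)) •
              (Matrix.fromBlocks
                (Matrix.diagonal fun jl : Fin m × Fin K => if jl.2 = l then (γ l)⁻¹ else 0)
                0 0 (0 : Matrix (Fin m) (Fin m) ℝ)).map Polynomial.C
          + ∑ l : Fin K, ((Polynomial.X : Polynomial ℝ) ^ (e + d l)) •
              (Matrix.fromBlocks (0 : Matrix (Fin m × Fin K) (Fin m × Fin K) ℝ) 0 0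
                (γ l • (1 : Matrix (Fin m) (Fin m) ℝ) - T l)).map Polynomial.C := by
      simp only [κ, Fintype.sum_sum_type, d', P, Sum.elim_inl, Sum.elim_inr]
    rw [hsum, ← add_assoc] at hC
    obtain ⟨a, M, ha, hdet⟩ :=
      Summit.ValiantsHypothesis.ValiantsHypothesis.Theorems.LacunarySymmetroidMatrixDescartes.stub_liftDet
        K m γ hγ d e he T
    rwa [posRoots_eq_of_eq_C_mul_X_pow_mul _ _ a M ha hdet] at hC
  -- the two lifts and the bookkeeping
  have hSneg : ∀ l, (((-1 : ℝ) ^ d l) • S l).IsSymm := fun l => (hS l).smul _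
  have hA := hlift S hS
  have hB := hlift (fun l => ((-1 : ℝ) ^ d l) • S l) hSneg
  exact stub_arith3 K q _ _ _ hK4 hKq (stub_negRoots K m d S) hA hB

/-- **The line's composition**: the crux, by name, from the stubs. -/
theorem MatrixDescartes_of :
    Summit.ValiantsHypothesis.ValiantsHypothesis.Theses.LacunarySymmetroid.MatrixDescartes :=
  MatrixDescartes_of_oneIndefinitePos oneIndefinitePos_of_stubs

/-! ## K-dependent sector sub-goals (v6, lead c3) — registered; ALL LANDED (wave 1) and discharged here (v7)

Every K-free rung of `stub_twoSided` is dead (p159188, p161614), so the honest sub-laws carry `K` (or the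
format).  The following are the sectors and composition rules that the route header, the strategist and the
disprover quote as paper facts; they are registered here so that workers land them as kernel theorems
(`--supports stmt-ValiantsHypothesis-18050`).  None of them is used by `MatrixDescartes_of` (they are rungs and
negation-map constraints, not a decomposition of the crux). -/

/-- SUB-GOAL (diagonal sector): if every coefficient is diagonal, `Sₗ = diagonal (γ l)`, then
`det (∑ₗ X^{dₗ} Sₗ) = ∏ᵢ (∑ₗ γ l i · X^{dₗ})` is a product of `m` polynomials with at most `K` monomials
each, so it has at most `m (K − 1)` distinct positive zeros (sparse Descartes, tree
`Literature.Computability.AlgebraicComplexity.card_roots_toFinset_filter_pos_lt_card_support`).  Degenerate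
cases: `K = 0` gives the zero matrix (`m > 0`: `det = 0`, no roots counted) or the empty one (`m = 0`). -/
theorem stub_diagonalSector (K m : ℕ) (d : Fin K → ℕ) (γ : Fin K → Fin m → ℝ) :
    ((Matrix.det (∑ l, ((Polynomial.X : Polynomial ℝ) ^ d l) •
        (Matrix.diagonal (γ l)).map Polynomial.C)).roots.toFinset.filter (fun t => 0 < t)).card
      ≤ m * (K - 1) := 
  Summit.ValiantsHypothesis.ValiantsHypothesis.Theorems.LacunarySymmetroidMatrixDescartes.stub_diagonalSector K m d γ

/-- SUB-GOAL (commuting sector — the route header's "commuting `Sₗ`: `Z ≤ m(2K−1)`" in positive-root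
currency): pairwise commuting real SYMMETRIC coefficients are simultaneously orthogonally diagonalisable
(Mathlib `LinearMap.IsSymmetric.directSum_isInternal_of_pairwise_commute` +
`DirectSum.IsInternal.subordinateOrthonormalBasis`, as in `Matrix.IsHermitian.spectral_theorem`), so
`det (∑ₗ X^{dₗ} Sₗ) = ∏ᵢ (∑ₗ γ_{l,i} X^{dₗ})` and the diagonal sector applies: `Z₊ ≤ m (K − 1)`. -/
theorem stub_commutingSector (K m : ℕ) (d : Fin K → ℕ) (S : Fin K → Matrix (Fin m) (Fin m) ℝ)
    (hS : ∀ l, (S l).IsSymm) (hcomm : ∀ l l', S l * S l' = S l' * S l) :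
    ((Matrix.det (∑ l, ((Polynomial.X : Polynomial ℝ) ^ d l) • (S l).map Polynomial.C)).roots.toFinset.filter
        (fun t => 0 < t)).card ≤ m * (K - 1) := 
  Summit.ValiantsHypothesis.ValiantsHypothesis.Theorems.LacunarySymmetroidMatrixDescartes.stub_commutingSector K m d S hS hcomm

/-- SUB-GOAL (block sums are additive): the block-diagonal pencil with blocks `Sₗ ⊕ Tₗ` has determinant
`det (∑ X^{dₗ} Sₗ) · det (∑ X^{dₗ} Tₗ)` (`Matrix.det_fromBlocks_zero₂₁`), so its distinct real zeros number at
most `Z(S) + Z(T)` (if either factor is the zero polynomial the product has no counted roots). -/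
theorem stub_blockSector (K m n : ℕ) (d : Fin K → ℕ) (S : Fin K → Matrix (Fin m) (Fin m) ℝ)
    (T : Fin K → Matrix (Fin n) (Fin n) ℝ) :
    (Matrix.det (∑ l, ((Polynomial.X : Polynomial ℝ) ^ d l) •
        (Matrix.fromBlocks (S l) 0 0 (T l)).map Polynomial.C)).roots.toFinset.card
      ≤ (Matrix.det (∑ l, ((Polynomial.X : Polynomial ℝ) ^ d l) • (S l).map Polynomial.C)).roots.toFinset.card
        + (Matrix.det (∑ l, ((Polynomial.X : Polynomial ℝ) ^ d l) • (T l).map Polynomial.C)).roots.toFinset.card := 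
  Summit.ValiantsHypothesis.ValiantsHypothesis.Theorems.LacunarySymmetroidMatrixDescartes.stub_blockSector K m n d S T

/-- SUB-GOAL (Kronecker products are additive): the Kronecker product of two lacunary pencils is the lacunary
pencil `∑_{(l,k)} X^{dₗ+eₖ} (Sₗ ⊗ₖ Tₖ)` (bilinearity of `Matrix.kroneckerMap`), and
`det (A ⊗ₖ B) = det A ^ n · det B ^ m` (`Matrix.det_kronecker`), so its distinct real zeros number at most
`Z(S) + Z(T)`. -/
theorem stub_kroneckerSector (K K' m n : ℕ) (d : Fin K → ℕ) (e : Fin K' → ℕ)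
    (S : Fin K → Matrix (Fin m) (Fin m) ℝ) (T : Fin K' → Matrix (Fin n) (Fin n) ℝ) :
    (Matrix.det (∑ p : Fin K × Fin K', ((Polynomial.X : Polynomial ℝ) ^ (d p.1 + e p.2)) •
        (Matrix.kroneckerMap (· * ·) (S p.1) (T p.2)).map Polynomial.C)).roots.toFinset.card
      ≤ (Matrix.det (∑ l, ((Polynomial.X : Polynomial ℝ) ^ d l) • (S l).map Polynomial.C)).roots.toFinset.card
        + (Matrix.det (∑ k, ((Polynomial.X : Polynomial ℝ) ^ e k) • (T k).map Polynomial.C)).roots.toFinset.card := 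
  Summit.ValiantsHypothesis.ValiantsHypothesis.Theorems.LacunarySymmetroidMatrixDescartes.stub_kroneckerSector K K' m n d e S T

/-- SUB-GOAL (the sharp Descartes ceiling by count vectors): the exponents of `det (∑ₗ X^{dₗ} Sₗ)` lie in
`{∑ₗ nₗ dₗ : n a count vector, ∑ nₗ = m}` (Leibniz expansion by row-to-term maps `f : Fin m → Fin K`; the
exponent `∑ᵢ d (f i)` depends only on the multiset of values of `f`, an element of `Sym (Fin K) m`, of which
there are `C(K+m−1, m)` — Mathlib `Sym.card_sym_eq_choose`), so by the sparse Descartes rule the number of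
distinct positive zeros is `< C(m+K−1, m)` whenever `K ≥ 1` (for `det = 0` no root is counted and
`C(m+K−1, m) ≥ 1`). Descartes-extremality of witnesses ((2,3): 5, (2,4): 9, (m,3): `C(m+2,2) − 1`) is measured
against exactly this number. -/
theorem stub_descartesCeiling (K m : ℕ) (hK : 0 < K) (d : Fin K → ℕ)
    (S : Fin K → Matrix (Fin m) (Fin m) ℝ) :
    ((Matrix.det (∑ l, ((Polynomial.X : Polynomial ℝ) ^ d l) • (S l).map Polynomial.C)).roots.toFinset.filter
        (fun t => 0 < t)).card + 1 ≤ Nat.choose (m + K - 1) m := 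
  Summit.ValiantsHypothesis.ValiantsHypothesis.Theorems.LacunarySymmetroidMatrixDescartes.stub_descartesCeiling K m hK d S

/-! ## The tropical door needs super-quasi-polynomial Birkhoff shadows (v8, lead c3) — registered sub-goals, ALL LANDED
(wave 2: p168648 `stub_dominantInjective`, p169104 `stub_shadowEmbed`, p168639 `stub_shadowTransport`, p168739
`stub_shadowArith`; discharged here in v9; the composition is proposed as
`Theorems/LacunarySymmetroidMatrixDescartesTropicalDoorShadows.lean`, p169192)

`TropicalMonster → ¬ MatrixDescartes` is a tree theorem (p164927).  Conversely the door is at least as hard as a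
named open problem: a `TropicalMonster` yields, infinitely often in `n`, a linear plane projection of the `n × n`
permutation matrices with more than `2^((⌊log₂ n⌋ + c)^c)` vertices for every `c` — the `∃^∞` form of the
sibling item `DivisionGap.ShadowBirkhoff` (Hrubeš–Yehudayoff 2021, Open Problem 1 asks even for `2^{Ω(n)}`;
printed knowledge is `2^{Θ(log² n)} ≤ σ(DS_n) ≤ 2^{O(n)}`, tree `HrubesYehudayoff2021_prop23_lower/upper`).
The embedding: a multi-class design on `m` nodes with `K` classes becomes a weight table on the node set
`Fin m × Fin (K+2)` (column `(i,0)`, row `(i,1)`, ports `(i,l+2)`); the Leibniz term `(σ, λ)` is the permutation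
`(i,0) ↦ (i, λ i + 2) ↦ (σ i, 1) ↦ (σ i, 0)`, unused ports fixed; pattern arcs carry `(d_l, 0)`, `(0, −v)`,
`(0,0)`, every other pair a penalty; a dominant term is then the strict unique maximiser of `(x,y) ↦ θ x + y`
over the projected permutation matrices, hence a vertex (tree
`BirkhoffShadowLower.mem_extremePoints_convexHull_of_forall_lt`). -/

section ShadowDoor

open Summit.ValiantsHypothesis.ValiantsHypothesis.Theorems.MatrixDescartes.Negative
open Literature.Computability.AlgebraicComplexity

/-- SUB-GOAL (dominant terms at increasing slopes with alternating signs are pairwise distinct): adjacent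
ones differ because their signs do; non-adjacent ones because the set of slopes at which a fixed term is
the unique optimum is an interval (tropical weights are affine in `θ`), which would swallow the term in
between. -/
theorem stub_dominantInjective (m K : ℕ) (d : Fin K → ℕ) (v ε : Fin m → Fin m → Fin K → ℤ) (B : ℕ)
    (θ : Fin (B + 1) → ℤ) (p : Fin (B + 1) → Equiv.Perm (Fin m) × (Fin m → Fin K))
    (hθ : StrictMono θ) (hdom : ∀ k, IsDominant d v ε (θ k) (p k))
    (halt : ∀ k : Fin B, termSign ε (p k.castSucc) * termSign ε (p k.succ) < 0) :
    Function.Injective p := 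
  Summit.ValiantsHypothesis.ValiantsHypothesis.Theorems.LacunarySymmetroidMatrixDescartes.stub_dominantInjective m K d v ε B θ p hθ hdom halt

/-- SUB-GOAL (the embedding): `B + 1` pairwise distinct Leibniz terms, each the unique optimum of the design
at some integer slope, give `B + 1` vertices of a plane shadow of the permutation matrices on the node set
`Fin m × Fin (K + 2)` (columns, rows, ports; pattern arcs weighted by the design, all other pairs penalised). -/
theorem stub_shadowEmbed (m K : ℕ) (d : Fin K → ℕ) (v ε : Fin m → Fin m → Fin K → ℤ) (B : ℕ)
    (θ : Fin (B + 1) → ℤ) (p : Fin (B + 1) → Equiv.Perm (Fin m) × (Fin m → Fin K))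
    (hdom : ∀ k, IsDominant d v ε (θ k) (p k)) (hp : Function.Injective p) :
    ∃ L : ((Fin m × Fin (K + 2)) × (Fin m × Fin (K + 2)) → ℝ) →ₗ[ℝ] (Fin 2 → ℝ),
      B + 1 ≤ Set.ncard (Set.extremePoints ℝ (convexHull ℝ (L ''
        {x | ∃ ρ : Equiv.Perm (Fin m × Fin (K + 2)), x = fun ij => if ρ ij.2 = ij.1 then 1 else 0}))) := 
  Summit.ValiantsHypothesis.ValiantsHypothesis.Theorems.LacunarySymmetroidMatrixDescartes.stub_shadowEmbed m K d v ε B θ p hdom hp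

/-- SUB-GOAL (transport of shadows along a relabelling of the nodes): the plane shadows of the permutation
matrices do not depend on how the node set is enumerated. -/
theorem stub_shadowTransport (α : Type) [Fintype α] [DecidableEq α] (n : ℕ) (e : α ≃ Fin n)
    (L : (α × α → ℝ) →ₗ[ℝ] (Fin 2 → ℝ)) :
    ∃ L' : (Fin n × Fin n → ℝ) →ₗ[ℝ] (Fin 2 → ℝ),
      L' '' permMatrixPoints n = L '' {x | ∃ ρ : Equiv.Perm α, x = fun ij => if ρ ij.2 = ij.1 then 1 else 0} := 
  Summit.ValiantsHypothesis.ValiantsHypothesis.Theorems.LacunarySymmetroidMatrixDescartes.stub_shadowTransport α n e L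

/-- SUB-GOAL (the regime arithmetic of the door): in the regime `m ≤ 2^((⌊log₂K⌋+c₀)^c₀)`, a breakpoint count
with `B^q > 2^(K⌊log₂K⌋)` beats every quasi-polynomial `2^((⌊log₂ n⌋ + c)^c)` in the node count `n = m(K+2)` of
the embedding, for all large `K`. -/
theorem stub_shadowArith (c₀ q c : ℕ) : ∃ K₁ : ℕ, ∀ K m B : ℕ, K₁ ≤ K →
    m ≤ 2 ^ ((Nat.log 2 K + c₀) ^ c₀) → 2 ^ (K * Nat.log 2 K) < B ^ q →
    2 ^ ((Nat.log 2 (m * (K + 2)) + c) ^ c) < B + 1 := 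
  Summit.ValiantsHypothesis.ValiantsHypothesis.Theorems.LacunarySymmetroidMatrixDescartes.stub_shadowArith c₀ q c

/-- **The tropical door needs super-quasi-polynomial Birkhoff shadows.**  A `TropicalMonster` (the hypothesis
of the tree's `MatrixDescartes_false_of_TropicalMonster`) gives, for every `c` and infinitely many `n`, a linear
plane projection of the `n × n` permutation matrices whose convex hull has more than `2^((⌊log₂ n⌋+c)^c)`
extreme points — the infinitely-often form of `DivisionGap.ShadowBirkhoff` (Hrubeš–Yehudayoff 2021, Open
Problem 1, weak form).  Composition of the four sub-goals above. -/
theorem shadowBirkhoffIO_of_tropicalMonster (hT : TropicalMonster) :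
    ∀ c n₀ : ℕ, ∃ n : ℕ, n₀ ≤ n ∧ ∃ L : (Fin n × Fin n → ℝ) →ₗ[ℝ] (Fin 2 → ℝ),
      2 ^ ((Nat.log 2 n + c) ^ c) <
        Set.ncard (Set.extremePoints ℝ (convexHull ℝ (L '' permMatrixPoints n))) := by
  intro c n₀
  obtain ⟨c₀, q, hq, hK⟩ := hT
  obtain ⟨K₁, hK₁⟩ := stub_shadowArith c₀ q c
  obtain ⟨K, m, hKge, hm, d, v, ε, B, θ, p, _hε, hθ, hdom, halt, hB⟩ := hK (max K₁ n₀)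
  have hinj : Function.Injective p := stub_dominantInjective m K d v ε B θ p hθ hdom halt
  -- `m = 0` is impossible: there would be a single Leibniz term, so `B = 0`, contradicting `2^(K log K) < B^q`
  have hm1 : 1 ≤ m := by
    rcases Nat.eq_zero_or_pos m with h0 | h0
    · exfalso
      subst h0
      have hcard : B + 1 ≤ 1 := by
        have h := Fintype.card_le_of_injective p hinj
        simpa using h
      have hB0 : B = 0 := by omega
      subst hB0
      rw [zero_pow (Nat.pos_iff_ne_zero.1 hq)] at hB
      exact (Nat.not_lt_zero _) hB
    · exact h0
  obtain ⟨L, hL⟩ := stub_shadowEmbed m K d v ε B θ p hdom hinj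
  obtain ⟨L', hL'⟩ := stub_shadowTransport (Fin m × Fin (K + 2)) (m * (K + 2)) finProdFinEquiv L
  refine ⟨m * (K + 2), ?_, L', ?_⟩
  · calc n₀ ≤ max K₁ n₀ := le_max_right _ _
      _ ≤ K := hKge
      _ ≤ 1 * (K + 2) := by omega
      _ ≤ m * (K + 2) := Nat.mul_le_mul_right _ hm1
  · rw [hL']
    exact lt_of_lt_of_le (hK₁ K m B (le_trans (le_max_left _ _) hKge) hm hB) hL

end ShadowDoor

/-! ## The V-configuration rung (v10, lead c3) — registered sub-goals of `stub_twoSided`'s territory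

Every K-free rung is dead and the honest sub-laws carry the exponent CONFIGURATION.  The smallest undecided one
is the V-configuration: ONE PSD exponent below the pivot and ONE above (`κ` with two exponent values), i.e.
`det (X^e J + X^{d₁} P + X^{d₂} Q)`, `d₁ < e < d₂`, `P, Q ⪰ 0`, `J` symmetric.  CONJECTURE (V-law): at most
`2 · card ι` distinct positive zeros — sub-Descartes from `n = 3` on (Descartes allows `C(n+2,2) − 1`), TRUE at
`n = 1` (trinomial) and `n = 2` (six-term exponential sum whose extreme coefficients are `det P, det Q ≥ 0`:
parity + sparsity give ≤ 4 sign variations), and numerically SHARP for `n = 3, 4`: forcing `2n + 1` zeros by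
Levenberg–Marquardt continuation always requires `P` or `Q` to lose semidefiniteness (`‖P − Q‖ → 1⁺` in the
normal form `P + Q = I`; the extra zero enters from infinity exactly at the PSD boundary), see
`Cruxes/MatrixDescartes/Lines/Lift-vlaw.md` (reductions to a sector statement for matrix trinomials
`x^m I + x^p J + Q` and to the zero count of `det(αQ − βI + e^{iθ}J)` on the positive quadrant; evidence files).
`stub_vLaw_two` LANDED (p170725, wave 3; Descartes + the parity half of the rule of signs) and is discharged below;
`stub_vLaw` is RESEARCH-LEVEL (no proof known; registered so that the disprover and siege seats attack the
sharpest true-looking statement of the two-sided core). -/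

/-- SUB-GOAL (V-law at `n = 2`, provable now): for 2×2 real matrices with `P, Q ⪰ 0` and exponents
`d₁ < e < d₂`, `det (X^e J + X^{d₁} P + X^{d₂} Q)` has at most `4` distinct positive zeros.  Proof: the
determinant has support in `{2d₁, d₁+e, 2e, d₁+d₂, e+d₂, 2d₂}` (six exponents, `2d₁` and `2d₂` extreme and
unshared) with coefficients `det P ≥ 0` at `2d₁` and `det Q ≥ 0` at `2d₂`; if either vanishes the support has
≤ 5 elements (< 5 sign variations... ≤ 4 positive roots by `signVariations_lt_card_support`); if both are
positive the sign sequence starts and ends with `+`, so the number of sign variations is EVEN and `< 6`, hence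
`≤ 4`; conclude with Mathlib's Descartes rule `Polynomial.roots_countP_pos_le_signVariations`. -/
theorem stub_vLaw_two (e d₁ d₂ : ℕ) (J P Q : Matrix (Fin 2) (Fin 2) ℝ)
    (hP : P.PosSemidef) (hQ : Q.PosSemidef) (h₁ : d₁ < e) (h₂ : e < d₂) :
    ((Matrix.det (((Polynomial.X : Polynomial ℝ) ^ e) • J.map Polynomial.C
        + ((Polynomial.X : Polynomial ℝ) ^ d₁) • P.map Polynomial.C
        + ((Polynomial.X : Polynomial ℝ) ^ d₂) • Q.map Polynomial.C)).roots.toFinset.filter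
          (fun t => 0 < t)).card ≤ 4 := 
  Summit.ValiantsHypothesis.ValiantsHypothesis.Theorems.LacunarySymmetroidMatrixDescartes.stub_vLaw_two e d₁ d₂ J P Q hP hQ h₁ h₂

/-- SUB-GOAL (V-law, general `n`; RESEARCH-LEVEL conjecture, numerically sharp — see the section docstring
and `Lines/Lift-vlaw.md`): one PSD term below and one above a symmetric pivot give at most `2 · card ι`
distinct positive zeros of the determinant. -/
theorem stub_vLaw (ι : Type) [Fintype ι] [DecidableEq ι] (e d₁ d₂ : ℕ) (J P Q : Matrix ι ι ℝ)
    (hJ : J.IsSymm) (hP : P.PosSemidef) (hQ : Q.PosSemidef) (h₁ : d₁ < e) (h₂ : e < d₂) :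
    ((Matrix.det (((Polynomial.X : Polynomial ℝ) ^ e) • J.map Polynomial.C
        + ((Polynomial.X : Polynomial ℝ) ^ d₁) • P.map Polynomial.C
        + ((Polynomial.X : Polynomial ℝ) ^ d₂) • Q.map Polynomial.C)).roots.toFinset.filter
          (fun t => 0 < t)).card ≤ 2 * Fintype.card ι := by
  -- LANDED (`…StubVLaw`, `stub_vLaw` — the V-law PROVED, statement verbatim; val-sym-mdr-p2 lineage): by-name citation
  -- (stub-credit wiring val-port-1 g1, val-lit RULING #246 (a); desk/tenure GO required for the registered skeleton).
  exact Summit.ValiantsHypothesis.ValiantsHypothesis.Theorems.LacunarySymmetroidMatrixDescartes.stub_vLaw ι e d₁ d₂ J P Q hJ hP hQ h₁ h₂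

/-! ## The commuting two-sided rung (v12, lead c3) — registered sub-goal, LANDED (p171068, wave 4), discharged in v13

In the COMMUTATIVE world the two-sided core obeys `Z₊ ≤ 2·(size)` for EVERY number of PSD exponents: after a
joint diagonalisation each diagonal entry `jᵢ X^e + Σₖ pₖᵢ X^{dₖ}` (`pₖᵢ ≥ 0`) has at most one negative
coefficient, hence ≤ 2 sign variations, hence ≤ 2 positive zeros (Descartes).  So every excess over `2n` in
`stub_twoSided` (rank-one witness p159188: `Z₊ = 6 > 4` at n = 2 with PSD exponents on both sides of the pivot)
is a NON-COMMUTATIVE phenomenon; together with the V-law (first non-commutative configuration, conjecturally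
still `2n`) this locates where the two-sided core starts paying for non-commutativity: at ≥ 2 PSD exponents on
at least one side. -/

/-- SUB-GOAL (commuting two-sided rung, provable now): if `J` and all `P k` are real symmetric, the `P k` are
positive semidefinite, and the whole family commutes pairwise, then `det (X^e J + Σₖ X^{dₖ} Pₖ)` has at most
`2m` distinct positive zeros — for any number of terms and any exponents.  Route: view `(J, P)` as one commuting
family `Fin (K+1) → Matrix` with exponents `Fin.cons e d` (`Fin.sum_univ_succ`), apply the landed
`StubCommutingSector.exists_jointEigenmatrix` / `det_pencil_eq_of_intertwine` (p167802) and
`StubDiagonalSector.pencil_eq_diagonal` (p167534); the diagonal values of each `P k` are eigenvalues, hence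
`≥ 0`; a real polynomial with at most one negative coefficient has ≤ 2 sign variations
(`Polynomial.signVariations_eraseLead`, `signVariations_eq_eraseLead_add_ite`), so ≤ 2 positive roots by
`Polynomial.roots_countP_pos_le_signVariations`; sum over the `m` factors. -/
theorem stub_commutingTwoSided (K m e : ℕ) (d : Fin K → ℕ) (J : Matrix (Fin m) (Fin m) ℝ)
    (P : Fin K → Matrix (Fin m) (Fin m) ℝ) (hJ : J.IsSymm) (hP : ∀ k, (P k).PosSemidef)
    (hJP : ∀ k, J * P k = P k * J) (hPP : ∀ k k', P k * P k' = P k' * P k) :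
    ((Matrix.det (((Polynomial.X : Polynomial ℝ) ^ e) • J.map Polynomial.C
        + ∑ k, ((Polynomial.X : Polynomial ℝ) ^ d k) • (P k).map Polynomial.C)).roots.toFinset.filter
          (fun t => 0 < t)).card ≤ 2 * m := 
  Summit.ValiantsHypothesis.ValiantsHypothesis.Theorems.LacunarySymmetroidMatrixDescartes.stub_commutingTwoSided K m e d J P hJ hP hJP hPP

/-! ## The V-law's configuration hypothesis is load-bearing (v14, lead c3) — registered calibration, LANDED (p171347, wave 5)

With TWO PSD exponents below the pivot and one above ((2,1)-configuration), `2n` is already exceeded at `n = 2`: zero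
forcing (exp/config_fit.py, rates `{1,3} | {2}`) found pencils with 6 positive zeros, and an integer witness is
`det(X³ J + X² P₁ + P₂ + X⁵ Q)` with `J = [[620, −260], [−260, −2720]]`, `P₁ = v₁v₁ᵀ + w₁w₁ᵀ` for
`(v₁, w₁) = ((0,0), (20,38))`, i.e. `P₁ = [[400,760],[760,1444]]`, `P₂ = [[625,985],[985,1553]]` (columns `(−20,−32)`,
`(−15,−23)`), `Q = [[117,−258],[−258,569]]` (columns `(−9,20)`, `(−6,13)`), whose determinant alternates in sign at
`t = 3/16, 7/32, 25/32, 13/16, 29/16, 77/16, 105` (`+,−,+,−,+,−,+`), hence has ≥ 6 > 4 distinct positive zeros.  So the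
V-law (`stub_vLaw`) is the exact frontier: one exponent per side ⇒ 2n; two on one side ⇒ 3n occurs at n = 2 (as for the
(2,2) witnesses p159188, p161614). -/

/-- SUB-GOAL (calibration, provable now by the explicit witness above and the tree lemma
`le_card_posRoots_of_alternating`): the (2,1)-configuration analogue of the n = 2 V-law is FALSE. -/
theorem not_wLaw_two : ¬ ∀ (e d₁ d₂ d₃ : ℕ) (J P₁ P₂ Q : Matrix (Fin 2) (Fin 2) ℝ),
    P₁.PosSemidef → P₂.PosSemidef → Q.PosSemidef → d₂ < d₁ → d₁ < e → e < d₃ →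
    ((Matrix.det (((Polynomial.X : Polynomial ℝ) ^ e) • J.map Polynomial.C
        + ((Polynomial.X : Polynomial ℝ) ^ d₁) • P₁.map Polynomial.C
        + ((Polynomial.X : Polynomial ℝ) ^ d₂) • P₂.map Polynomial.C
        + ((Polynomial.X : Polynomial ℝ) ^ d₃) • Q.map Polynomial.C)).roots.toFinset.filter
          (fun t => 0 < t)).card ≤ 2 * 2 := 
  Summit.ValiantsHypothesis.ValiantsHypothesis.Theorems.LacunarySymmetroidMatrixDescartes.not_wLaw_two

end Summit.ValiantsHypothesis.ValiantsHypothesis.Cruxes.MatrixDescartes.Lift
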